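import Mathlib
import Literature.Analysis.FluidPDE.SuitableWeak
import Summits.NavierStokesRegularity.NavierStokesRegularity.Theorems.EulerZoomLiouvillePowerGaugeEulerLiouvilleBirthDefs
import Summits.NavierStokesRegularity.NavierStokesRegularity.Theorems.EulerZoomLiouvillePowerGaugeEulerLiouvilleAePastSteady
import Summits.NavierStokesRegularity.NavierStokesRegularity.Theorems.EulerZoomLiouvillePowerGaugeEulerLiouvillePastFrameSteadyConfined
import HarnessLib

/-!
# Crux `EulerZoomLiouville.PowerGaugeEulerLiouville` (stmt-NavierStokesRegularity-19832), stub `stub_nonSelfSimilarRest`: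
# members that are AFFINE IN TIME on a past slab (`∂ₜ²u = 0` in the a.e. sense) are trivial

Helper file (theorems only; `--supports stmt-NavierStokesRegularity-19832`; def-free).  Hand leafhand-ns-eulerzoomliouville-11 g0;
the "next idea" named by hand 10 g3's census (`∂ₜ²u = 0 ⟹ trivial`), in its almost-everywhere form.

THE STRATUM.  A member `(u, p, H, c)` of Seregin's power-gauged class (suitable weak Euler pair on `(−∞,0) × ℝ³`, weak spatial
gradient `H`, gauges `a^{2ρ} A(a) + a^{ρ} E(a) + a^{2ρ} D(a) ≤ c` at the origin, `ρ > 0`) whose velocity is AFFINE IN TIME on a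
past slab — `u(τ, x) = U₀(x) + τ U₁(x)` for a.e. `(τ, x) ∈ (−∞, T₁) × ℝ³`, some `T₁ ≤ 0`, `U₀, U₁ : ℝ³ → ℝ³` ARBITRARY (no
measurability, regularity or decay assumed) — vanishes a.e. on the whole slab (`AffinePast.ae_eq_zero_of_gauge_of_aeAffinePast`,
binder form `Birth.nonSelfSimilar_of_aeAffineTimePast`).  These are the flows with a FROZEN EULERIAN ACCELERATION `∂ₜu = U₁(x)`;
the case `U₁ = 0` is the a.e.-steady stratum of hand 10 g3 (`AePastSteady`), which is the last step here.

PROOF (large-scale arithmetic of the `A`-gauge; the Euler system enters only through the a.e.-steady stratum at the end).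
(1) Slicing: for a.e. `τ < T₁` the slice `u(τ)` is locally integrable (`FrameSteady.ae_hasWeakFDerivOn_slice_past`) and equals
`U₀ + τ U₁` a.e. on `ℝ³`.  (2) The `A`-gauge gives `∫_{B_a} |u(s)|² ≤ c a^{1−2ρ}` for every `s ∈ (−a², 0)`
(`Backward.lintegral_ball_le_of_gaugeA`).  For `a² ≥ 4(1 − T₁)` pick GOOD times `τ₁ ∈ (−a², −a²/2)` and `τ₂ ∈ (T₁ − 1, T₁)`; then
`τ₂ − τ₁ ≥ a²/4` and `(τ₂ − τ₁) U₁ = u(τ₂) − u(τ₁)` a.e., so `(a²/4)² ∫_{B_a} |U₁|² ≤ 4 c a^{1−2ρ}`, i.e.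
`∫_{B_R} |U₁|² ≤ 64 c a^{−3−2ρ}` for every `R ≤ a`.  (3) `a → ∞`: `U₁ = 0` a.e. on every ball, hence on `ℝ³`.  (4) So
`u(τ, x) = U₀(x)` a.e. on the past slab and `AePastSteady.ae_eq_zero_of_gauge_of_aePastSteady` concludes.

WHAT THIS IS NOT: not a proof of the stub or of the crux; nothing about Navier–Stokes; one more regularity-free stratum of
`stub_nonSelfSimilarRest` closed by name. [folklore]
-/

noncomputable section

-- flat `Theorems/<Route><Decl>…` files of one crux share the namespace of the crux (tree convention)
set_option linter.dupNamespace false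

open MeasureTheory Set Filter Topology Metric Function TopologicalSpace
open scoped RealInnerProductSpace NNReal ENNReal

namespace Summit.NavierStokesRegularity.NavierStokesRegularity.Theorems.PowerGaugeEulerLiouville

open Literature.Analysis Literature.Analysis.FunctionSpaces Literature.Analysis.FluidPDE

namespace AffinePast

/-! ## 1. Slicing an a.e. identity on a past slab -/

/-- From an a.e. property on the past slab `(−∞,T₁) × ℝ³` to a.e. slices: for a.e. `τ < T₁`, the property holds for a.e. `x`.
[folklore] -/
theorem ae_ae_of_ae_slab {P : ℝ → EuclideanSpace ℝ (Fin 3) → Prop} {T₁ : ℝ}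
    (h : ∀ᵐ z ∂(volume.restrict (Iio T₁ ×ˢ (univ : Set (EuclideanSpace ℝ (Fin 3))))), P z.1 z.2) :
    ∀ᵐ τ ∂(volume.restrict (Iio T₁)), ∀ᵐ x ∂(volume : Measure (EuclideanSpace ℝ (Fin 3))), P τ x := by
  have e : (volume.restrict (Iio T₁ ×ˢ (univ : Set (EuclideanSpace ℝ (Fin 3)))) : Measure (ℝ × EuclideanSpace ℝ (Fin 3))) =
      ((volume : Measure ℝ).restrict (Iio T₁)).prod (volume : Measure (EuclideanSpace ℝ (Fin 3))) := by
    rw [Measure.volume_eq_prod, ← Measure.restrict_univ (μ := (volume : Measure (EuclideanSpace ℝ (Fin 3)))),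
      Measure.prod_restrict, Measure.restrict_univ]
  rw [e] at h
  exact Measure.ae_ae_of_ae_prod h

/-- Conversely, an a.e. property on `ℝ³` holds for a.e. point of the past slab (in the second variable). [folklore] -/
theorem ae_slab_of_ae {Q : EuclideanSpace ℝ (Fin 3) → Prop} {T₁ : ℝ}
    (h : ∀ᵐ x ∂(volume : Measure (EuclideanSpace ℝ (Fin 3))), Q x) :
    ∀ᵐ z ∂(volume.restrict (Iio T₁ ×ˢ (univ : Set (EuclideanSpace ℝ (Fin 3))))), Q z.2 := by
  have e : (volume.restrict (Iio T₁ ×ˢ (univ : Set (EuclideanSpace ℝ (Fin 3)))) : Measure (ℝ × EuclideanSpace ℝ (Fin 3))) =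
      ((volume : Measure ℝ).restrict (Iio T₁)).prod (volume : Measure (EuclideanSpace ℝ (Fin 3))) := by
    rw [Measure.volume_eq_prod, ← Measure.restrict_univ (μ := (volume : Measure (EuclideanSpace ℝ (Fin 3)))),
      Measure.prod_restrict, Measure.restrict_univ]
  rw [e]
  exact (Measure.quasiMeasurePreserving_snd (μ := (volume : Measure ℝ).restrict (Iio T₁))
    (ν := (volume : Measure (EuclideanSpace ℝ (Fin 3))))).ae h

/-! ## 2. The two-slice estimate: the `A`-gauge growth kills the linear-in-time coefficient -/

/-- Pointwise: `‖(τ₂ − τ₁) • w‖² ≤ 2 (‖v₀ + τ₂ • w‖² + ‖v₀ + τ₁ • w‖²)`, in the extended-norm form used under `∫⁻`. [folklore] -/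
theorem enorm_sq_smul_sub_le (v₀ w : EuclideanSpace ℝ (Fin 3)) (τ₁ τ₂ : ℝ) :
    ‖(τ₂ - τ₁) • w‖ₑ ^ 2 ≤ 2 * (‖v₀ + τ₂ • w‖ₑ ^ 2 + ‖v₀ + τ₁ • w‖ₑ ^ 2) := by
  have hid : (τ₂ - τ₁) • w = (v₀ + τ₂ • w) - (v₀ + τ₁ • w) := by
    rw [sub_smul, add_sub_add_left_eq_sub]
  have hreal : ‖(τ₂ - τ₁) • w‖ ^ 2 ≤ 2 * (‖v₀ + τ₂ • w‖ ^ 2 + ‖v₀ + τ₁ • w‖ ^ 2) := by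
    have h1 : ‖(τ₂ - τ₁) • w‖ ≤ ‖v₀ + τ₂ • w‖ + ‖v₀ + τ₁ • w‖ := by
      rw [hid]; exact norm_sub_le _ _
    have h0 : 0 ≤ ‖(τ₂ - τ₁) • w‖ := norm_nonneg _
    nlinarith [sq_nonneg (‖v₀ + τ₂ • w‖ - ‖v₀ + τ₁ • w‖), norm_nonneg (v₀ + τ₂ • w), norm_nonneg (v₀ + τ₁ • w)]
  have e1 : ‖(τ₂ - τ₁) • w‖ₑ ^ 2 = ENNReal.ofReal (‖(τ₂ - τ₁) • w‖ ^ 2) := by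
    rw [← ofReal_norm, ENNReal.ofReal_pow (norm_nonneg _)]
  have e2 : ‖v₀ + τ₂ • w‖ₑ ^ 2 = ENNReal.ofReal (‖v₀ + τ₂ • w‖ ^ 2) := by
    rw [← ofReal_norm, ENNReal.ofReal_pow (norm_nonneg _)]
  have e3 : ‖v₀ + τ₁ • w‖ₑ ^ 2 = ENNReal.ofReal (‖v₀ + τ₁ • w‖ ^ 2) := by
    rw [← ofReal_norm, ENNReal.ofReal_pow (norm_nonneg _)]
  rw [e1]
  calc ENNReal.ofReal (‖(τ₂ - τ₁) • w‖ ^ 2)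
      ≤ ENNReal.ofReal (2 * (‖v₀ + τ₂ • w‖ ^ 2 + ‖v₀ + τ₁ • w‖ ^ 2)) := ENNReal.ofReal_le_ofReal hreal
    _ = 2 * (‖v₀ + τ₂ • w‖ₑ ^ 2 + ‖v₀ + τ₁ • w‖ₑ ^ 2) := by
        rw [ENNReal.ofReal_mul (by norm_num : (0 : ℝ) ≤ 2), ENNReal.ofReal_ofNat,
          ENNReal.ofReal_add (sq_nonneg _) (sq_nonneg _), e2, e3]

/-- **Two-slice estimate.**  If the affine slices `U₀ + τᵢ • U₁` (`i = 1, 2`) have `∫_{B} ‖·‖² ≤ K` on a ball `B` and one of them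
is a.e.-strongly measurable there, then `‖τ₂ − τ₁‖² ∫_{B} ‖U₁‖² ≤ 4K`. [folklore] -/
theorem lintegral_coeff_le_of_two_slices {U₀ U₁ : EuclideanSpace ℝ (Fin 3) → EuclideanSpace ℝ (Fin 3)} {τ₁ τ₂ : ℝ}
    {μ : Measure (EuclideanSpace ℝ (Fin 3))} {K : ℝ≥0∞}
    (hmeas : AEStronglyMeasurable (fun x => U₀ x + τ₂ • U₁ x) μ)
    (h₁ : ∫⁻ x, ‖U₀ x + τ₁ • U₁ x‖ₑ ^ 2 ∂μ ≤ K) (h₂ : ∫⁻ x, ‖U₀ x + τ₂ • U₁ x‖ₑ ^ 2 ∂μ ≤ K) :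
    ‖τ₂ - τ₁‖ₑ ^ 2 * ∫⁻ x, ‖U₁ x‖ₑ ^ 2 ∂μ ≤ 4 * K := by
  have hne : ‖τ₂ - τ₁‖ₑ ^ 2 ≠ ∞ := ENNReal.pow_ne_top enorm_ne_top
  calc ‖τ₂ - τ₁‖ₑ ^ 2 * ∫⁻ x, ‖U₁ x‖ₑ ^ 2 ∂μ
      = ∫⁻ x, ‖(τ₂ - τ₁) • U₁ x‖ₑ ^ 2 ∂μ := by
        rw [← lintegral_const_mul' _ _ hne]
        refine lintegral_congr fun x => ?_
        rw [enorm_smul, mul_pow]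
    _ ≤ ∫⁻ x, 2 * (‖U₀ x + τ₂ • U₁ x‖ₑ ^ 2 + ‖U₀ x + τ₁ • U₁ x‖ₑ ^ 2) ∂μ :=
        lintegral_mono fun x => enorm_sq_smul_sub_le (U₀ x) (U₁ x) τ₁ τ₂
    _ = 2 * (∫⁻ x, ‖U₀ x + τ₂ • U₁ x‖ₑ ^ 2 ∂μ + ∫⁻ x, ‖U₀ x + τ₁ • U₁ x‖ₑ ^ 2 ∂μ) := by
        rw [lintegral_const_mul' _ _ (by norm_num), lintegral_add_left' (hmeas.enorm.pow_const 2)]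
    _ ≤ 2 * (K + K) := by gcongr
    _ = 4 * K := by rw [← two_mul, ← mul_assoc]; norm_num

/-! ## 3. The member theorem -/

/-- **MEMBERS THAT ARE AFFINE IN TIME A.E. ON A PAST SLAB ARE TRIVIAL.**  Let `(u, p)` be a suitable weak Euler pair on
`(−∞,0) × ℝ³` with weak spatial gradient `H` and gauges `a^{2ρ} A(a) + a^{ρ} E(a) + a^{2ρ} D(a) ≤ c` (`ρ > 0`), and suppose
`u(τ, x) = U₀(x) + τ U₁(x)` for a.e. `(τ, x) ∈ (−∞, T₁) × ℝ³`, some `T₁ ≤ 0` and some `U₀, U₁ : ℝ³ → ℝ³` (no measurability,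
regularity or decay assumed).  Then `u = 0` a.e. on the slab: the `A`-gauge growth `∫_{B_a}|u(s)|² ≤ c a^{1−2ρ}` on two good
slices a time `≥ a²/4` apart gives `∫_{B_R}|U₁|² ≤ 64 c a^{−3−2ρ} → 0`, so `U₁ = 0` a.e., the member is a.e. steady in the past,
and `AePastSteady.ae_eq_zero_of_gauge_of_aePastSteady` applies. [folklore] -/
theorem ae_eq_zero_of_gauge_of_aeAffinePast {ρ : ℝ} (hρ : 0 < ρ)
    {u : ℝ → EuclideanSpace ℝ (Fin 3) → EuclideanSpace ℝ (Fin 3)} {p : ℝ → EuclideanSpace ℝ (Fin 3) → ℝ}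
    {H : ℝ → EuclideanSpace ℝ (Fin 3) → EuclideanSpace ℝ (Fin 3) →L[ℝ] EuclideanSpace ℝ (Fin 3)} {c : ℝ≥0}
    (hsw : IsSuitableWeakSolutionOn (slab (EuclideanSpace ℝ (Fin 3)) (Iio 0) isOpen_Iio) 0 0 u p)
    (hH : HasWeakSpatialGradientOn (slab (EuclideanSpace ℝ (Fin 3)) (Iio 0) isOpen_Iio) u H)
    (hc : ∀ a : ℝ, 0 < a → ENNReal.ofReal (a ^ (2 * ρ)) * cknA a (0 : ℝ × EuclideanSpace ℝ (Fin 3)) u +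
        ENNReal.ofReal (a ^ ρ) * cknE a (0 : ℝ × EuclideanSpace ℝ (Fin 3)) H +
        ENNReal.ofReal (a ^ (2 * ρ)) * cknD a (0 : ℝ × EuclideanSpace ℝ (Fin 3)) p ≤ (c : ℝ≥0∞))
    {T₁ : ℝ} (hT₁ : T₁ ≤ 0) {U₀ U₁ : EuclideanSpace ℝ (Fin 3) → EuclideanSpace ℝ (Fin 3)}
    (hU : ∀ᵐ z ∂(volume.restrict (Iio T₁ ×ˢ (univ : Set (EuclideanSpace ℝ (Fin 3))))),
      u z.1 z.2 = U₀ z.2 + z.1 • U₁ z.2) :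
    uncurry u =ᵐ[volume.restrict (Iio (0 : ℝ) ×ˢ (univ : Set (EuclideanSpace ℝ (Fin 3))))] 0 := by
  -- (1) good slices: a.e. `τ < T₁`, `u τ` is locally integrable and equals the affine slice a.e.
  have hgood : ∀ᵐ τ ∂(volume.restrict (Iio T₁)),
      LocallyIntegrable (u τ) volume ∧ ∀ᵐ x ∂(volume : Measure (EuclideanSpace ℝ (Fin 3))), u τ x = U₀ x + τ • U₁ x := by
    filter_upwards [FrameSteady.ae_hasWeakFDerivOn_slice_past hH hT₁,
      ae_ae_of_ae_slab (P := fun τ x => u τ x = U₀ x + τ • U₁ x) hU] with τ hτ hτ'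
    exact ⟨locallyIntegrableOn_univ.1 (by simpa only [Opens.coe_top] using hτ.locallyIntegrableOn), hτ'⟩
  -- the `A`-gauge alone
  have hA : ∀ a : ℝ, 0 < a →
      ENNReal.ofReal (a ^ (2 * ρ)) * cknA a (0 : ℝ × EuclideanSpace ℝ (Fin 3)) u ≤ (c : ℝ≥0∞) :=
    fun a ha => le_trans (le_add_right (le_add_right le_rfl)) (hc a ha)
  -- (2) for every `a` with `a² ≥ 4 (1 - T₁)`: two good slices `≥ a²/4` apart, hence the coefficient bound on `B_a`
  have hstep : ∀ a : ℝ, 0 < a → 4 * (1 - T₁) ≤ a ^ 2 →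
      AEStronglyMeasurable U₁ volume ∧
      ∫⁻ x in ball (0 : EuclideanSpace ℝ (Fin 3)) a, ‖U₁ x‖ₑ ^ 2 ≤
        ENNReal.ofReal (64 * (c : ℝ) * a ^ (-(3 + 2 * ρ))) := by
    intro a ha ha2
    -- good time `τ₁ ∈ (−a², −a²/2)`
    have hwin₁ : volume (Ioo (-(a ^ 2)) (-(a ^ 2) / 2)) ≠ 0 := by
      rw [Real.volume_Ioo]; exact (ENNReal.ofReal_pos.2 (by nlinarith)).ne'
    have hsub₁ : Ioo (-(a ^ 2)) (-(a ^ 2) / 2) ⊆ Iio T₁ := fun τ hτ => by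
      simp only [mem_Iio]; have := hτ.2; nlinarith
    obtain ⟨τ₁, hτ₁, hgood₁⟩ :=
      Measure.exists_mem_of_measure_ne_zero_of_ae hwin₁ (ae_restrict_of_ae_restrict_of_subset hsub₁ hgood)
    -- good time `τ₂ ∈ (T₁ − 1, T₁)`
    have hwin₂ : volume (Ioo (T₁ - 1) T₁) ≠ 0 := by
      rw [Real.volume_Ioo]; exact (ENNReal.ofReal_pos.2 (by linarith)).ne'
    have hsub₂ : Ioo (T₁ - 1) T₁ ⊆ Iio T₁ := fun τ hτ => hτ.2
    obtain ⟨τ₂, hτ₂, hgood₂⟩ :=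
      Measure.exists_mem_of_measure_ne_zero_of_ae hwin₂ (ae_restrict_of_ae_restrict_of_subset hsub₂ hgood)
    have hgap : a ^ 2 / 4 ≤ τ₂ - τ₁ := by
      have h1 := hτ₁.2; have h2 := hτ₂.1; nlinarith
    -- slice bounds at the good times
    have hwinτ₁ : τ₁ ∈ Ioo (-(a ^ 2)) 0 := ⟨hτ₁.1, by have := hτ₁.2; nlinarith⟩
    have hwinτ₂ : τ₂ ∈ Ioo (-(a ^ 2)) 0 := ⟨by have := hτ₂.1; nlinarith, lt_of_lt_of_le hτ₂.2 hT₁⟩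
    have hb₁ : ∫⁻ x in ball (0 : EuclideanSpace ℝ (Fin 3)) a, ‖U₀ x + τ₁ • U₁ x‖ₑ ^ 2 ≤
        ENNReal.ofReal ((c : ℝ) * a ^ (1 - 2 * ρ)) := by
      have h := Backward.lintegral_ball_le_of_gaugeA ha (hA a ha) hwinτ₁
      refine le_of_eq_of_le ?_ h
      refine lintegral_congr_ae (ae_restrict_of_ae ?_)
      filter_upwards [hgood₁.2] with x hx
      rw [hx]
    have hb₂ : ∫⁻ x in ball (0 : EuclideanSpace ℝ (Fin 3)) a, ‖U₀ x + τ₂ • U₁ x‖ₑ ^ 2 ≤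
        ENNReal.ofReal ((c : ℝ) * a ^ (1 - 2 * ρ)) := by
      have h := Backward.lintegral_ball_le_of_gaugeA ha (hA a ha) hwinτ₂
      refine le_of_eq_of_le ?_ h
      refine lintegral_congr_ae (ae_restrict_of_ae ?_)
      filter_upwards [hgood₂.2] with x hx
      rw [hx]
    -- measurability of the affine slices and of `U₁`
    have hm₁ : AEStronglyMeasurable (fun x => U₀ x + τ₁ • U₁ x) volume :=
      hgood₁.1.aestronglyMeasurable.congr hgood₁.2
    have hm₂ : AEStronglyMeasurable (fun x => U₀ x + τ₂ • U₁ x) volume :=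
      hgood₂.1.aestronglyMeasurable.congr hgood₂.2
    have h4 : 0 < a ^ 2 / 4 := by positivity
    have hne : τ₂ - τ₁ ≠ 0 := by linarith
    have hU₁meas : AEStronglyMeasurable U₁ volume := by
      have e : U₁ = (τ₂ - τ₁)⁻¹ • ((fun x => U₀ x + τ₂ • U₁ x) - fun x => U₀ x + τ₁ • U₁ x) := by
        funext x
        simp only [Pi.smul_apply, Pi.sub_apply]
        rw [add_sub_add_left_eq_sub, ← sub_smul, smul_smul, inv_mul_cancel₀ hne, one_smul]
      rw [e]
      exact (hm₂.sub hm₁).const_smul _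
    refine ⟨hU₁meas, ?_⟩
    -- the two-slice estimate on `B_a`
    have hkey := lintegral_coeff_le_of_two_slices (μ := volume.restrict (ball (0 : EuclideanSpace ℝ (Fin 3)) a))
      hm₂.restrict hb₁ hb₂
    -- arithmetic: divide by `‖τ₂ − τ₁‖² ≥ (a²/4)²`
    have hgap' : ENNReal.ofReal ((a ^ 2 / 4) ^ 2) ≤ ‖τ₂ - τ₁‖ₑ ^ 2 := by
      rw [← ofReal_norm, ← ENNReal.ofReal_pow (norm_nonneg _), Real.norm_eq_abs,
        abs_of_nonneg (by linarith [show 0 ≤ a ^ 2 / 4 by positivity])]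
      exact ENNReal.ofReal_le_ofReal (pow_le_pow_left₀ (by positivity) hgap 2)
    have hpos : ENNReal.ofReal ((a ^ 2 / 4) ^ 2) ≠ 0 := by
      rw [ENNReal.ofReal_ne_zero_iff]; positivity
    have h1 : ENNReal.ofReal ((a ^ 2 / 4) ^ 2) * ∫⁻ x in ball (0 : EuclideanSpace ℝ (Fin 3)) a, ‖U₁ x‖ₑ ^ 2 ≤
        4 * ENNReal.ofReal ((c : ℝ) * a ^ (1 - 2 * ρ)) :=
      le_trans (mul_le_mul' hgap' le_rfl) hkey
    have h2 : ∫⁻ x in ball (0 : EuclideanSpace ℝ (Fin 3)) a, ‖U₁ x‖ₑ ^ 2 ≤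
        (ENNReal.ofReal ((a ^ 2 / 4) ^ 2))⁻¹ * (4 * ENNReal.ofReal ((c : ℝ) * a ^ (1 - 2 * ρ))) := by
      rw [← ENNReal.div_eq_inv_mul]
      exact ENNReal.le_div_iff_mul_le (Or.inl hpos) (Or.inl ENNReal.ofReal_ne_top) |>.2 (by rwa [mul_comm])
    refine le_trans h2 (le_of_eq ?_)
    rw [← ENNReal.ofReal_inv_of_pos (by positivity), ← ENNReal.ofReal_ofNat, ← ENNReal.ofReal_mul (by norm_num),
      ← ENNReal.ofReal_mul (by positivity)]
    congr 1
    have ha' : a ≠ 0 := ha.ne'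
    rw [show (-(3 + 2 * ρ) : ℝ) = (1 - 2 * ρ) + (-4 : ℝ) by ring, Real.rpow_add ha, Real.rpow_neg ha.le,
      show (4 : ℝ) = ((4 : ℕ) : ℝ) by norm_num, Real.rpow_natCast]
    field_simp
    ring
  -- (3) `U₁ = 0` a.e. on every ball, hence on `ℝ³`
  obtain ⟨a₀, ha₀pos, ha₀⟩ : ∃ a₀ : ℝ, 0 < a₀ ∧ 4 * (1 - T₁) ≤ a₀ ^ 2 := by
    refine ⟨2 * (1 - T₁), by linarith, ?_⟩
    nlinarith
  have hU₁meas : AEStronglyMeasurable U₁ volume := (hstep a₀ ha₀pos ha₀).1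
  have hball : ∀ R : ℝ, 0 < R → ∫⁻ x in ball (0 : EuclideanSpace ℝ (Fin 3)) R, ‖U₁ x‖ₑ ^ 2 = 0 := by
    intro R hR
    refine nonpos_iff_eq_zero.1 ?_
    -- `∫_{B_R} ≤ 64 c a^{-(3+2ρ)}` for all large `a`, and the right-hand side tends to `0`
    have hlim : Tendsto (fun a : ℝ => ENNReal.ofReal (64 * (c : ℝ) * a ^ (-(3 + 2 * ρ)))) atTop (𝓝 0) := by
      rw [show (0 : ℝ≥0∞) = ENNReal.ofReal (64 * (c : ℝ) * 0) by simp]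
      exact ENNReal.tendsto_ofReal ((tendsto_rpow_neg_atTop (by linarith)).const_mul _)
    refine ge_of_tendsto hlim ?_
    filter_upwards [eventually_ge_atTop (max a₀ R)] with a ha
    have haR : R ≤ a := le_trans (le_max_right _ _) ha
    have ha₀a : a₀ ≤ a := le_trans (le_max_left _ _) ha
    have hapos : 0 < a := lt_of_lt_of_le hR haR
    have ha2 : 4 * (1 - T₁) ≤ a ^ 2 := le_trans ha₀ (pow_le_pow_left₀ ha₀pos.le ha₀a 2)
    exact le_trans (lintegral_mono_set (ball_subset_ball haR)) (hstep a hapos ha2).2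
  have hU₁zero : ∀ᵐ x ∂(volume : Measure (EuclideanSpace ℝ (Fin 3))), U₁ x = 0 := by
    have hballae : ∀ n : ℕ, ∀ᵐ x ∂(volume.restrict (ball (0 : EuclideanSpace ℝ (Fin 3)) ((n : ℝ) + 1))), U₁ x = 0 := by
      intro n
      have h0 := hball ((n : ℝ) + 1) (by positivity)
      have h1 := (lintegral_eq_zero_iff' (hU₁meas.restrict.enorm.pow_const 2)).1 h0
      filter_upwards [h1] with x hx
      simpa using hx
    have h := (ae_restrict_iUnion_iff (μ := (volume : Measure (EuclideanSpace ℝ (Fin 3))))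
      (fun n : ℕ => ball (0 : EuclideanSpace ℝ (Fin 3)) ((n : ℝ) + 1)) (fun x => U₁ x = 0)).2 hballae
    rwa [iUnion_ball_nat_succ, Measure.restrict_univ] at h
  -- (4) the member is a.e. steady in the past
  have hU' : ∀ᵐ z ∂(volume.restrict (Iio T₁ ×ˢ (univ : Set (EuclideanSpace ℝ (Fin 3))))), u z.1 z.2 = U₀ z.2 := by
    filter_upwards [hU, ae_slab_of_ae (T₁ := T₁) hU₁zero] with z hz hz0
    rw [hz, hz0, smul_zero, add_zero]
  exact AePastSteady.ae_eq_zero_of_gauge_of_aePastSteady hρ hsw hH hc hT₁ hU'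

/-- Shifted time origin: `u(τ, x) = U₀(x) + (τ − t₀) U₁(x)` a.e. on a past slab ⇒ trivial (absorb `−t₀ U₁` into `U₀`). [folklore] -/
theorem ae_eq_zero_of_gauge_of_aeAffinePast_shifted {ρ : ℝ} (hρ : 0 < ρ)
    {u : ℝ → EuclideanSpace ℝ (Fin 3) → EuclideanSpace ℝ (Fin 3)} {p : ℝ → EuclideanSpace ℝ (Fin 3) → ℝ}
    {H : ℝ → EuclideanSpace ℝ (Fin 3) → EuclideanSpace ℝ (Fin 3) →L[ℝ] EuclideanSpace ℝ (Fin 3)} {c : ℝ≥0}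
    (hsw : IsSuitableWeakSolutionOn (slab (EuclideanSpace ℝ (Fin 3)) (Iio 0) isOpen_Iio) 0 0 u p)
    (hH : HasWeakSpatialGradientOn (slab (EuclideanSpace ℝ (Fin 3)) (Iio 0) isOpen_Iio) u H)
    (hc : ∀ a : ℝ, 0 < a → ENNReal.ofReal (a ^ (2 * ρ)) * cknA a (0 : ℝ × EuclideanSpace ℝ (Fin 3)) u +
        ENNReal.ofReal (a ^ ρ) * cknE a (0 : ℝ × EuclideanSpace ℝ (Fin 3)) H +
        ENNReal.ofReal (a ^ (2 * ρ)) * cknD a (0 : ℝ × EuclideanSpace ℝ (Fin 3)) p ≤ (c : ℝ≥0∞))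
    {T₁ : ℝ} (hT₁ : T₁ ≤ 0) (t₀ : ℝ) {U₀ U₁ : EuclideanSpace ℝ (Fin 3) → EuclideanSpace ℝ (Fin 3)}
    (hU : ∀ᵐ z ∂(volume.restrict (Iio T₁ ×ˢ (univ : Set (EuclideanSpace ℝ (Fin 3))))),
      u z.1 z.2 = U₀ z.2 + (z.1 - t₀) • U₁ z.2) :
    uncurry u =ᵐ[volume.restrict (Iio (0 : ℝ) ×ˢ (univ : Set (EuclideanSpace ℝ (Fin 3))))] 0 := by
  refine ae_eq_zero_of_gauge_of_aeAffinePast hρ hsw hH hc hT₁ (U₀ := fun x => U₀ x - t₀ • U₁ x) (U₁ := U₁) ?_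
  filter_upwards [hU] with z hz
  rw [hz, sub_smul]
  abel

end AffinePast

/-! ## 4. Binder language (`Birth.InClass`) -/

/-- **Binder language: AFFINE-IN-TIME PAST ⇒ TRIVIAL** — `u(τ, x) = U₀(x) + τ U₁(x)` for a.e. `(τ, x) ∈ (−∞,T₁) × ℝ³`, some `T₁ ≤ 0`,
some `U₀ U₁ : ℝ³ → ℝ³` (no measurability, regularity or decay; `U₁ = 0` is the a.e.-steady stratum) ⇒ `u = 0` a.e.
(`AffinePast.ae_eq_zero_of_gauge_of_aeAffinePast`).  Equivalently: members with a frozen Eulerian acceleration `∂ₜu = U₁(x)` on a past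
slab are trivial. [folklore] -/
theorem Birth.nonSelfSimilar_of_aeAffineTimePast :
    ∀ ρ : ℝ, 0 < ρ →
      ∀ (u : ℝ → EuclideanSpace ℝ (Fin 3) → EuclideanSpace ℝ (Fin 3)) (p : ℝ → EuclideanSpace ℝ (Fin 3) → ℝ)
        (H : ℝ → EuclideanSpace ℝ (Fin 3) → EuclideanSpace ℝ (Fin 3) →L[ℝ] EuclideanSpace ℝ (Fin 3)) (c : ℝ≥0),
        Birth.InClass ρ u p H c →
          (∃ T₁ : ℝ, T₁ ≤ 0 ∧ ∃ U₀ U₁ : EuclideanSpace ℝ (Fin 3) → EuclideanSpace ℝ (Fin 3),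
              ∀ᵐ z ∂(volume.restrict (Iio T₁ ×ˢ (univ : Set (EuclideanSpace ℝ (Fin 3))))),
                u z.1 z.2 = U₀ z.2 + z.1 • U₁ z.2) →
          uncurry u =ᵐ[volume.restrict (Iio (0 : ℝ) ×ˢ (univ : Set (EuclideanSpace ℝ (Fin 3))))] 0 := by
  intro ρ hρ u p H c hcl h
  obtain ⟨T₁, hT₁, U₀, U₁, hU⟩ := h
  exact AffinePast.ae_eq_zero_of_gauge_of_aeAffinePast hρ hcl.1 hcl.2.1 hcl.2.2 hT₁ hU

/-- **Binder language, shifted time origin**: `u(τ, x) = U₀(x) + (τ − t₀) U₁(x)` a.e. on `(−∞,T₁) × ℝ³` ⇒ `u = 0` a.e. [folklore] -/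
theorem Birth.nonSelfSimilar_of_aeAffineTimePast_shifted :
    ∀ ρ : ℝ, 0 < ρ →
      ∀ (u : ℝ → EuclideanSpace ℝ (Fin 3) → EuclideanSpace ℝ (Fin 3)) (p : ℝ → EuclideanSpace ℝ (Fin 3) → ℝ)
        (H : ℝ → EuclideanSpace ℝ (Fin 3) → EuclideanSpace ℝ (Fin 3) →L[ℝ] EuclideanSpace ℝ (Fin 3)) (c : ℝ≥0),
        Birth.InClass ρ u p H c →
          (∃ T₁ : ℝ, T₁ ≤ 0 ∧ ∃ t₀ : ℝ, ∃ U₀ U₁ : EuclideanSpace ℝ (Fin 3) → EuclideanSpace ℝ (Fin 3),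
              ∀ᵐ z ∂(volume.restrict (Iio T₁ ×ˢ (univ : Set (EuclideanSpace ℝ (Fin 3))))),
                u z.1 z.2 = U₀ z.2 + (z.1 - t₀) • U₁ z.2) →
          uncurry u =ᵐ[volume.restrict (Iio (0 : ℝ) ×ˢ (univ : Set (EuclideanSpace ℝ (Fin 3))))] 0 := by
  intro ρ hρ u p H c hcl h
  obtain ⟨T₁, hT₁, t₀, U₀, U₁, hU⟩ := h
  exact AffinePast.ae_eq_zero_of_gauge_of_aeAffinePast_shifted hρ hcl.1 hcl.2.1 hcl.2.2 hT₁ t₀ hU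

end Summit.NavierStokesRegularity.NavierStokesRegularity.Theorems.PowerGaugeEulerLiouville

end
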